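import Mathlib
import Summits.Langlands.Langlands.Theorems.ParityBlindBianchiIcosahedralQuadraticDescentFrobRoots
import Literature.NumberTheory.Automorphic.TunnellLemma
import Literature.NumberTheory.Automorphic.ChebotarevArtinRepHolds
import Literature.NumberTheory.GaloisRepresentations.SGeneralQuadraticFamily

/-!
# Icosahedral descent (crux `IcosahedralDescentLevel`, line `Sketch`) — the witness place

Chebotarev's density theorem (existence form, `chebotarev_artinRep_holds`) with `g = 1` for a
rank-two Artin representation `ρ` of `Γ_ℚ`: off any finite set of finite places of `ℚ` there is a
place `v₁`, over an odd rational prime `ℓ₁`, at which `ρ` is unramified with Frobenius roots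
`{1, 1}` (some arithmetic Frobenius above `v₁` acts as `ρ(1) = 1`, the scalar `1`).
-/

-- `Summit.Langlands.Langlands.…`: the repeated path component is the tree's layout (D-0017).
set_option linter.dupNamespace false

noncomputable section

open scoped MatrixGroups NumberField Polynomial Classical
open NumberField IsDedekindDomain Field Filter
open Literature.NumberTheory.Automorphic Literature.NumberTheory.GaloisRepresentations
open Literature.NumberTheory.GaloisRepresentations.QuadraticFamily
open Summit.Langlands.Langlands.Theorems.IcosahedralQuadraticDescent

namespace Summit.Langlands.Langlands.Theorems.IcosahedralDescentLevel

/-- Finitely many finite places of `ℚ` contain `2` (finitely many primes contain a given non-zero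
element). [folklore] -/
private theorem finite_setOf_two_mem :
    {v : HeightOneSpectrum (𝓞 ℚ) | ((2 : ℕ) : 𝓞 ℚ) ∈ v.asIdeal}.Finite := by
  have h20 : ((2 : ℕ) : 𝓞 ℚ) ≠ 0 := by exact_mod_cast (two_ne_zero : (2 : ℕ) ≠ 0)
  have hfin := Ideal.finite_factors
    ((Ideal.span_singleton_eq_bot (α := 𝓞 ℚ)).not.mpr h20 : Ideal.span {((2 : ℕ) : 𝓞 ℚ)} ≠ ⊥)
  exact hfin.subset fun w hw => Ideal.dvd_span_singleton.mpr hw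

/-- **The witness place.**  Chebotarev with `g = 1`: off any finite set `X` of finite places of
`ℚ` there is a place `v₁` of `ℚ`, over an odd rational prime `ℓ₁`, at which `ρ` is unramified
with Frobenius roots `{1, 1}`. [folklore] -/
theorem exists_witness_place (ρ : FramedArtinRep ℚ 2) (X : Set (HeightOneSpectrum (𝓞 ℚ))) (hX : X.Finite) :
    ∃ (v₁ : HeightOneSpectrum (𝓞 ℚ)) (ℓ₁ : ℕ), v₁ ∉ X ∧ ℓ₁.Prime ∧ ℓ₁ ≠ 2 ∧
      ((ℓ₁ : ℕ) : 𝓞 ℚ) ∈ v₁.asIdeal ∧ ρ.IsUnramifiedAt v₁ ∧ frobRoots ρ v₁ = {1, 1} := by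
  have hinf := chebotarev_artinRep_holds ℚ 2 ρ 1
  have hbad : (X ∪ {v : HeightOneSpectrum (𝓞 ℚ) | ((2 : ℕ) : 𝓞 ℚ) ∈ v.asIdeal}).Finite :=
    hX.union finite_setOf_two_mem
  obtain ⟨v₁, ⟨hunr, 𝔓, h𝔓, φ, hφ, hρφ⟩, hv₁⟩ := (hinf.sdiff hbad).nonempty
  simp only [Set.mem_union, Set.mem_setOf_eq, not_or] at hv₁
  obtain ⟨hv₁X, hv₁2⟩ := hv₁
  obtain ⟨ℓ₁, hℓ₁, hℓ₁v⟩ := exists_prime_natCast_mem v₁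
  refine ⟨v₁, ℓ₁, hv₁X, hℓ₁, ?_, hℓ₁v, hunr, ?_⟩
  · rintro rfl
    exact hv₁2 hℓ₁v
  · have hu : ρ φ = Matrix.GeneralLinearGroup.scalar (Fin 2) 1 := by
      rw [hρφ, map_one, map_one]
    rw [frobRoots_eq_pair_of_apply_eq_scalar ρ hunr h𝔓 hφ hu, Units.val_one]

end Summit.Langlands.Langlands.Theorems.IcosahedralDescentLevel

end
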